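import Literature.Topology.FourManifolds.FlowerMelonPlanar
import Literature.Topology.FourManifolds.FlowerSectorWord
import Literature.Topology.FourManifolds.FlowerMarkingTransport
import Literature.Topology.FourManifolds.OneHandleStepExists
import HarnessLib

/-!
# The melon decomposition of the flower surface and its marking by `S_g`

This file completes the computation of the fundamental group of the **flower surface**
`Z_g = {p ∈ ℝ³ | thicken (flower g) p = level g}` (the boundary of the genus-`g` flower handlebody,
`g ≥ 2`) and assembles statement **(g′)** of the trisection functor: granted the standard one-handle
lemma `oneHandle_nonempty_diffeomorph` (L1), the central surface of every balanced `(g, k)`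
Gay–Kirby trisection is marked by the surface group `S_g`
(`exists_marking_centralSurface_of_gkTrisection_of_oneHandle`), and since L1 is proved
(`oneHandle_nonempty_diffeomorph_holds`, file `OneHandleStepExists`) this discharges the named fact:
`exists_marking_centralSurface_of_gkTrisection_holds`.

## The argument (Hatcher, §1.2, the surface group via van Kampen; here organised as a "melon")

The `g`-fold rotational symmetry `rot3 ζ` of the flower handlebody cuts `Z_g` into `g` congruent
**slices** `S_k = rot3 (ζ^k)⁻¹ '' S_0` (`secS`), the images of the standard sector
`S_0 = sectorZ g = Z_g ∩ π⁻¹(wedge)`, meeting along the `g` pole-to-pole **arcs**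
`δ_k = rot3 (ζ^k)⁻¹ ∘ vArc` (`arcK`) over the edge rays of the wedges; consecutive slices `S_{k-1}`,
`S_k` meet exactly in `δ_k`, and `δ_g = δ_0` closes the melon.  The abstract melon theorem
`exists_surfaceGroup_mulEquiv_of_melon` (file `SurfaceGroupMelon`) computes
`π₁(⋃ S_k) ≅ S_g` from: closedness and path-connectedness of the slices (§1), the arcs and their
incidences (§2), open collars in which the arcs are strong deformation retracts of their
neighbourhoods on both sides (§3, transported from the fan collars `isStrongDeformationRetractOf_vArcSet_fan`
and `isStrongDeformationRetractOf_vRay2` of file `FlowerFanCollar` along the symmetries), and for each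
slice a free basis of `π₁(S_k) ≅ F₂` in which the boundary loop `δ_{k+1} · δ_k⁻¹` reads as the
commutator `surfaceRelator 1` (§4, the word computation `exists_basis_sectorZ_bdry` of file
`FlowerSectorWord`, transported along `rot3 (ζ^k)⁻¹`).  §5 instantiates the melon theorem
(`flowerSurface_marking`), and §6 feeds the marking into the transport theorem
`exists_marking_centralSurface_of_flower_marking`, together with the landed genus-`0` and genus-`1`
cases.

## References

* [cite: GayKirby2016, Def. 1] — D. Gay, R. Kirby, *Trisecting 4-manifolds*, Geom. Topol. 20 (2016):
  in a `(g, k)`-trisection the central surface `F = X₁ ∩ X₂ ∩ X₃` is a closed orientable surface of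
  genus `g` (part of the definition).
* [cite: HatcherAT2002, §1.2, pp. 50–52] — A. Hatcher, *Algebraic Topology*, CUP 2002: `π₁` of the
  closed orientable surface of genus `g` via van Kampen.
-/

open scoped Manifold ContDiff Topology InnerProductSpace Real unitInterval
open Set Function Filter Metric Module Complex

noncomputable section

universe u

namespace Literature.Topology.FourManifolds

/-- Local notation: `𝔼 n` is the model Euclidean space `EuclideanSpace ℝ (Fin n)`. -/
local notation "𝔼 " n:arg => EuclideanSpace ℝ (Fin n)

open PlanarThickening PlanarDouble Literature.AlgebraicTopology.Homotopy
  Literature.AlgebraicTopology.FundamentalGroup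

namespace FlowerModel

variable {g : ℕ}

/-! ### §1 The slices: rotated sectors -/

/-- **The rotation carrying the standard sector onto the `k`-th slice**: `rot3 (ζ^k)⁻¹`. [folklore] -/
def Rk (g k : ℕ) : 𝔼 3 ≃ₜ 𝔼 3 := rot3 (ζC g k)⁻¹

/-- The rotations fix the upper pole. [folklore] -/
theorem Rk_top (g k : ℕ) : Rk g k (top g) = top g := by
  rw [Rk, top, rot3_apply, map_add, map_smul, proj_lift, proj_ez, smul_zero, add_zero, map_zero]
  simp

/-- The rotations fix the lower pole. [folklore] -/
theorem Rk_bot (g k : ℕ) : Rk g k (bot g) = bot g := by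
  rw [Rk, bot, rot3_apply, map_add, map_smul, proj_lift, proj_ez, smul_zero, add_zero, map_zero]
  simp

variable (g) in
/-- **The `k`-th slice** of the flower surface: the image of the standard sector under `Rk`. [folklore] -/
def secS (k : ℕ) : Set (𝔼 3) := Rk g k '' sectorZ g

/-- **The `k`-th slice is the part of the flower surface over the `k`-th wedge.** [folklore] -/
theorem secS_eq (hg : 2 ≤ g) (k : ℕ) : secS g k = flowerSurface g ∩ proj ⁻¹' secW g k := by
  have hg1 : 1 ≤ g := by omega
  rw [secS, Rk, ← image_rot_inv_wedge hg k]
  exact image_rot3_inter_preimage (ζC_inv_pow hg1 k) (level g) (wedge g)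

/-- The `0`-th slice is the standard sector. [folklore] -/
theorem secS_zero (hg : 2 ≤ g) : secS g 0 = sectorZ g := by
  rw [secS_eq hg, secW_zero]; rfl

/-- The slices are compact. [folklore] -/
theorem isCompact_secS (hg : 2 ≤ g) (k : ℕ) : IsCompact (secS g k) := (isCompact_sectorZ hg).image (Rk g k).continuous

/-- The slices are closed. [folklore] -/
theorem isClosed_secS (hg : 2 ≤ g) (k : ℕ) : IsClosed (secS g k) := (isCompact_secS hg k).isClosed

/-- A space with a strong deformation retraction onto a set contained in a path-connected subset is
path connected. [folklore] -/
theorem isPathConnected_of_isStrongDeformationRetractOf {X : Type*} [TopologicalSpace X] {A S B : Set X}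
    (h : IsStrongDeformationRetractOf A S) (hAB : A ∩ S ⊆ B) (hBS : B ⊆ S) (hB : IsPathConnected B) :
    IsPathConnected S := by
  obtain ⟨H, h0, h1, -⟩ := h
  have hB' := hB
  obtain ⟨b, hb, -⟩ := hB'
  refine ⟨b, hBS hb, fun x hx => ?_⟩
  -- the track of `x` joins it to `H (1, x) ∈ A ∩ S ⊆ B`, and `B` is path connected inside `S`
  have htrack : JoinedIn S x (H (1, ⟨x, hx⟩) : X) := by
    refine ⟨⟨⟨fun t => (H (t, ⟨x, hx⟩) : X), by fun_prop⟩, by simp [h0], by simp⟩, fun t => (H (t, ⟨x, hx⟩)).2⟩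
  have hmem : (H (1, ⟨x, hx⟩) : X) ∈ B := hAB ⟨h1 _, (H (1, ⟨x, hx⟩)).2⟩
  exact ((hB.joinedIn b hb _ hmem).mono hBS).trans htrack.symm

/-- The presented ball with arcs is path connected. [folklore] -/
theorem isPathConnected_ballArcs' (hg : 2 ≤ g) : IsPathConnected (ballArcs' g hg) := by
  haveI : PathConnectedSpace (closedBall (0 : ℝ × ℝ) 1) :=
    isPathConnected_iff_pathConnectedSpace.1 ((convex_closedBall _ _).isPathConnected ⟨0, mem_closedBall_self zero_le_one⟩)
  haveI : PathConnectedSpace (closedBall (0 : ℝ) 1) :=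
    isPathConnected_iff_pathConnectedSpace.1 ((convex_closedBall _ _).isPathConnected ⟨0, mem_closedBall_self zero_le_one⟩)
  have hB : IsPathConnected (range (tipChart hg)) := isPathConnected_range (tipChart hg).continuous
  have harc : ∀ i, IsPathConnected (range (arcs hg i)) := fun i => isPathConnected_range (arcs hg i).continuous
  have hmeet : ∀ i, (range (tipChart hg) ∩ range (arcs hg i)).Nonempty := fun i =>
    ⟨arcs hg i ptPlus, (arcs_mem_range_iff hg i ptPlus).2 (by simp [ptPlus]), mem_range_self _⟩
  rw [ballArcs']
  have : (⋃ j, range (arcs hg j)) = range (arcs hg (0, false)) ∪ range (arcs hg (0, true)) := by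
    ext p; simp only [mem_iUnion, mem_union]
    constructor
    · rintro ⟨⟨j, b⟩, h⟩
      have hj : j = 0 := Subsingleton.elim _ _
      subst hj; cases b
      · exact Or.inl h
      · exact Or.inr h
    · rintro (h | h)
      · exact ⟨_, h⟩
      · exact ⟨_, h⟩
  rw [this, ← union_assoc]
  refine (IsPathConnected.union hB (harc _) (hmeet _) |>.union (harc _) ?_)
  obtain ⟨p, hp1, hp2⟩ := hmeet (0, true)
  exact ⟨p, Or.inl hp1, hp2⟩

/-- **The standard sector is path connected.** [folklore] -/
theorem isPathConnected_sectorZ (hg : 2 ≤ g) : IsPathConnected (sectorZ g) := by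
  refine isPathConnected_of_isStrongDeformationRetractOf (spineZ'_isStrongDeformationRetractOf_sectorZ hg)
    (fun p hp => ?_) (ballArcs'_subset_sectorZ hg) (isPathConnected_ballArcs' hg)
  rw [ballArcs'_eq hg]; exact Or.inl hp.1

/-- The slices are path connected. [folklore] -/
theorem isPathConnected_secS (hg : 2 ≤ g) (k : ℕ) : IsPathConnected (secS g k) :=
  (isPathConnected_sectorZ hg).image (Rk g k).continuous

/-! ### §2 The arcs -/

/-- **The `k`-th arc** from pole to pole: the rotated valley arc, over the edge ray `rayK k`. [folklore] -/
def arcK (hg : 2 ≤ g) (k : ℕ) : Path (top g) (bot g) :=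
  ((vArc hg).map (Rk g k).continuous).cast (Rk_top g k).symm (Rk_bot g k).symm

/-- The `k`-th arc, pointwise. [folklore] -/
theorem arcK_apply (hg : 2 ≤ g) (k : ℕ) (t : I) : arcK hg k t = Rk g k (vArc hg t) := rfl

/-- The range of the `k`-th arc is the rotated valley arc set. [folklore] -/
theorem range_arcK_eq_image (hg : 2 ≤ g) (k : ℕ) : range (arcK hg k) = Rk g k '' vArcSet g hg := by
  rw [← range_vArc hg, ← range_comp]; rfl

/-- **The range of the `k`-th arc is the part of the flower surface over the `k`-th edge ray.** [folklore] -/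
theorem range_arcK (hg : 2 ≤ g) (k : ℕ) : range (arcK hg k) = flowerSurface g ∩ proj ⁻¹' rayK g hg k := by
  have hg1 : 1 ≤ g := by omega
  rw [range_arcK_eq_image, vArcSet, Rk, ← image_rot_inv_vRay hg k]
  exact image_rot3_inter_preimage (ζC_inv_pow hg1 k) (level g) _

/-- The `k`-th arc lies in the `k`-th slice (its upper edge). [folklore] -/
theorem range_arcK_subset (hg : 2 ≤ g) (k : ℕ) : range (arcK hg k) ⊆ secS g k := by
  rw [range_arcK, secS_eq hg]
  exact inter_subset_inter_right _ (preimage_mono (rayK_subset_secW hg k))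

/-- The `(k+1)`-st arc lies in the `k`-th slice (its lower edge). [folklore] -/
theorem range_arcK_succ_subset (hg : 2 ≤ g) (k : ℕ) : range (arcK hg (k + 1)) ⊆ secS g k := by
  rw [range_arcK, secS_eq hg]
  exact inter_subset_inter_right _ (preimage_mono (rayK_succ_subset_secW hg k))

/-- The `0`-th arc is the valley arc. [folklore] -/
theorem arcK_zero (hg : 2 ≤ g) : arcK hg 0 = vArc hg := by
  apply Path.ext; funext t
  rw [arcK_apply, Rk]
  have : ζC g 0 = 1 := by simp [ζC]
  rw [this, inv_one, rot3_apply, rot_one, lift_proj_add]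

/-- **The arcs are `g`-periodic**: `arcK g = arcK 0`. [folklore] -/
theorem arcK_period (hg : 2 ≤ g) : arcK hg g = arcK hg 0 := by
  apply Path.ext; funext t
  rw [arcK_apply, arcK_apply, Rk, Rk, ζC_self (by omega)]
  simp [ζC]

/-- The projection of a point of the valley arc lies on the standard ray. [folklore] -/
theorem exists_proj_vArc (hg : 2 ≤ g) (t : I) : ∃ r, proj (vArc hg t) = pol r (π / g) := by
  rw [vArc_apply]
  rcases le_or_gt (2 * rho4 hg * t) (rho4 hg) with h | h
  · exact ⟨_, proj_vArcFun_of_le hg h⟩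
  · exact ⟨_, proj_vArcFun_of_lt hg h⟩

/-- **The next arc is the rotated mirrored arc**: `arcK (k+1) t = Rk k (δ₋ t)`. [folklore] -/
theorem arcK_succ_apply (hg : 2 ≤ g) (k : ℕ) (t : I) : arcK hg (k + 1) t = Rk g k (vArcR hg t) := by
  rw [arcK_apply, vArcR, Path.cast_coe, Path.map_coe, Function.comp_apply, Rk, Rk, rot3_apply, rot3_apply,
    refl3_apply_two, proj_refl3]
  obtain ⟨r, hr⟩ := exists_proj_vArc hg t
  rw [hr, refl_pol, ζC_inv_eq_exp, ζC_inv_eq_exp, rot_exp_pol, rot_exp_pol, νk, νk]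
  congr 3; push_cast; ring

/-- The arcs are injective. [folklore] -/
theorem injective_arcK (hg : 2 ≤ g) (k : ℕ) : Injective (arcK hg k) :=
  (Rk g k).injective.comp (injective_vArc hg)

/-- The arcs are simply connected. [folklore] -/
theorem isSimplyConnected_range_arcK (hg : 2 ≤ g) (k : ℕ) : IsSimplyConnected (range (arcK hg k)) := by
  rw [range_arcK_eq_image, (Rk g k).isEmbedding.isSimplyConnected_image]
  exact isSimplyConnected_vArcSet hg

/-- Points of the flower surface over the origin are the poles. [folklore] -/
theorem eq_top_or_bot_of_proj_eq_zero (hg : 1 ≤ g) {p : 𝔼 3} (hp : p ∈ flowerSurface g) (h0 : proj p = 0) :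
    p = top g ∨ p = bot g := by
  have hsq : p 2 ^ 2 = level g := by
    have := sq_eq_of_mem hp
    rw [h0, flower_zero hg, sub_zero] at this; exact this
  have hs : Real.sqrt (level g) ^ 2 = level g := Real.sq_sqrt (level_pos hg).le
  rcases eq_or_eq_neg_of_sq_eq_sq _ _ (hsq.trans hs.symm) with h | h
  · left
    rw [← lift_proj_add p, h0, h, top]
  · right
    rw [← lift_proj_add p, h0, h, bot]

/-- **The last edge ray meets the standard ray only at the origin** (`g = n + 2`). [folklore] -/
theorem eq_zero_of_mem_rayK_last_of_mem_vRay {n : ℕ} (hg : 2 ≤ n + 2) {u : 𝔼 2}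
    (h1 : u ∈ rayK (n + 2) hg (n + 1)) (h0 : u ∈ rayK (n + 2) hg 0) : u = 0 := by
  obtain ⟨r, hr, rfl⟩ := h1
  obtain ⟨r', hr', he⟩ := h0
  dsimp only at he ⊢
  set p : ℝ := π / (n + 2 : ℕ) with hp
  have hp0 : 0 < p := by positivity
  have hG : ((n + 2 : ℕ) : ℝ) ≠ 0 := by positivity
  have e2π : 2 * π = (2 * n + 4) * p := by rw [hp]; field_simp; push_cast; ring
  have e0 : (1 - 2 * ((0 : ℕ) : ℝ)) * π / (n + 2 : ℕ) = p := by rw [hp]; simp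
  have e1 : (1 - 2 * ((n + 1 : ℕ) : ℝ)) * π / (n + 2 : ℕ) = -((2 * n + 1) * p) := by rw [hp]; push_cast; ring
  rw [e0] at he
  rw [e1] at he ⊢
  rcases hr.1.eq_or_lt with h | h
  · rw [← h, pol_zero_left]
  exfalso
  -- equal norms, hence equal radii
  have hnorm : r' = r := by
    have := congrArg (fun v : 𝔼 2 => ‖v‖) he
    simp only [norm_pol, abs_of_nonneg hr.1, abs_of_nonneg hr'.1] at this; exact this
  subst hnorm
  -- equal unit complex numbers, hence angles differing by a multiple of `2π`
  have hc : Complex.exp (((p : ℝ) : ℂ) * Complex.I) = Complex.exp (((-((2 * n + 1) * p) : ℝ) : ℂ) * Complex.I) := by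
    have := congrArg toC he
    rw [toC_pol, toC_pol] at this
    exact mul_left_cancel₀ (by exact_mod_cast h.ne') this
  obtain ⟨m, hm⟩ := Complex.exp_eq_exp_iff_exists_int.1 hc
  have hre : p = -((2 * n + 1) * p) + m * (2 * π) := by
    have := congrArg Complex.im hm
    simpa using this
  rw [e2π] at hre
  -- `(2n + 2) p = m (2n + 4) p`, impossible for an integer `m`
  have key : (2 * (n : ℝ) + 2) = m * (2 * n + 4) := by
    have : (2 * (n : ℝ) + 2) * p = m * (2 * n + 4) * p := by linarith
    exact mul_right_cancel₀ hp0.ne' this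
  have hn : (0 : ℝ) ≤ n := by positivity
  rcases le_or_gt m 0 with hm0 | hm0
  · have : (m : ℝ) ≤ 0 := by exact_mod_cast hm0
    nlinarith
  · have : (1 : ℝ) ≤ m := by exact_mod_cast hm0
    nlinarith

/-- **The last arc meets the first only at the poles** (`g = n + 2`). [folklore] -/
theorem arcK_meet {n : ℕ} (hg : 2 ≤ n + 2) (s t : I) (h : arcK hg (n + 1) s = arcK hg 0 t) :
    (s = 0 ∧ t = 0) ∨ (s = 1 ∧ t = 1) := by
  have hg1 : 1 ≤ n + 2 := by omega
  have hs : arcK hg (n + 1) s ∈ range (arcK hg (n + 1)) := mem_range_self s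
  have ht : arcK hg 0 t ∈ range (arcK hg 0) := mem_range_self t
  rw [range_arcK] at hs ht
  rw [h] at hs
  have h0 : proj (arcK hg 0 t) = 0 := eq_zero_of_mem_rayK_last_of_mem_vRay hg hs.2 ht.2
  have hpole := eq_top_or_bot_of_proj_eq_zero hg1 ht.1 h0
  rw [arcK_zero] at h hpole
  -- `vArc t` is a pole, hence `t ∈ {0, 1}`; and `Rk (vArc s)` is the same pole, hence `s` too
  have hinj := injective_vArc hg
  have hv0 : vArc hg 0 = top (n + 2) := (vArc hg).source
  have hv1 : vArc hg 1 = bot (n + 2) := (vArc hg).target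
  rcases hpole with hp | hp
  · have ht0 : t = 0 := hinj (hp.trans hv0.symm)
    have hs0 : s = 0 := by
      apply injective_arcK hg (n + 1)
      rw [h, hp, (arcK hg (n + 1)).source]
    exact Or.inl ⟨hs0, ht0⟩
  · have ht1 : t = 1 := hinj (hp.trans hv1.symm)
    have hs1 : s = 1 := by
      apply injective_arcK hg (n + 1)
      rw [h, hp, (arcK hg (n + 1)).target]
    exact Or.inr ⟨hs1, ht1⟩

/-! ### §3 The collars -/

/-- The flower surface, unfolded. [folklore] -/
theorem flowerSurface_def : flowerSurface g = {p | thicken (flower g) p = level g} := rfl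

/-- Images of open planar sets under rotations are open. [folklore] -/
theorem isOpen_image_rot (a : Circle) {U : Set (𝔼 2)} (hU : IsOpen U) : IsOpen (rot a '' U) := by
  rw [← LinearIsometryEquiv.coe_toHomeomorph]; exact (rot a).toHomeomorph.isOpenMap _ hU

/-- Images of open planar sets under the reflection are open. [folklore] -/
theorem isOpen_image_refl {U : Set (𝔼 2)} (hU : IsOpen U) : IsOpen (refl '' U) := by
  rw [← LinearIsometryEquiv.coe_toHomeomorph]; exact refl.toHomeomorph.isOpenMap _ hU

/-- The image of a slice of the flower surface under `Rk`. [folklore] -/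
theorem image_Rk_inter (hg : 2 ≤ g) (k : ℕ) (W : Set (𝔼 2)) :
    Rk g k '' (flowerSurface g ∩ proj ⁻¹' W) = flowerSurface g ∩ proj ⁻¹' (rot (ζC g k)⁻¹ '' W) :=
  image_rot3_inter_preimage (ζC_inv_pow (by omega) k) (level g) W

/-- **The union of the first `m + 1` slices is the part of the flower surface over the fan.** [folklore] -/
theorem iUnion_secS_eq (hg : 2 ≤ g) {m : ℕ} (hm : m + 2 ≤ g) :
    ⋃ j ≤ m, secS g j = flowerSurface g ∩ proj ⁻¹' fanW g m := by
  rw [← iUnion_secW_eq_fanW hg hm, preimage_iUnion₂, inter_iUnion₂]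
  exact iUnion₂_congr fun j _ => secS_eq hg j

/-- **The collar of the `k`-th arc inside the `k`-th slice.** [folklore] -/
theorem collar_secS (hg : 2 ≤ g) (k : ℕ) : ∃ O : Set (𝔼 3), IsOpen O ∧ range (arcK hg k) ⊆ O ∧
    IsStrongDeformationRetractOf (range (arcK hg k)) (secS g k ∩ O) := by
  have h2 : 0 + 2 ≤ g := by omega
  have hT := (isStrongDeformationRetractOf_vArcSet_fan hg h2).image_of_isEmbedding (Rk g k).isEmbedding
  have e : Rk g k '' ({p | thicken (flower g) p = level g} ∩ proj ⁻¹' (fanW g 0 ∩ collarU g 0)) =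
      secS g k ∩ proj ⁻¹' (rot (ζC g k)⁻¹ '' collarU g 0) := by
    rw [← flowerSurface_def, image_Rk_inter hg, image_inter (rot _).injective, fanW_zero, image_rot_inv_wedge hg,
      preimage_inter, ← inter_assoc, ← secS_eq hg]
  rw [e, ← range_arcK_eq_image] at hT
  refine ⟨_, (isOpen_image_rot _ (isOpen_collarU hg h2)).preimage proj.continuous, ?_, hT⟩
  have hsub := image_mono (f := Rk g k) (vArcSet_subset_collar hg h2)
  rw [e, ← range_arcK_eq_image] at hsub
  exact hsub.trans inter_subset_right

/-- **The collar of the `k`-th arc inside the fan of the first `k` slices** (`1 ≤ k`, `k + 2 ≤ g`). [folklore] -/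
theorem collar_fan (hg : 2 ≤ g) {k : ℕ} (hk : 1 ≤ k) (hkg : k + 2 ≤ g) :
    ∃ O : Set (𝔼 3), IsOpen O ∧ range (arcK hg k) ⊆ O ∧
      IsStrongDeformationRetractOf (range (arcK hg k)) ((⋃ j ≤ k - 1, secS g j) ∩ O) := by
  obtain ⟨m, rfl⟩ : ∃ m, k = m + 1 := ⟨k - 1, by omega⟩
  have hm : m + 2 ≤ g := by omega
  simp only [Nat.add_sub_cancel]
  set τ : 𝔼 3 ≃ₜ 𝔼 3 := refl3.trans (Rk g m)
  have hT := (isStrongDeformationRetractOf_vArcSet_fan hg hm).image_of_isEmbedding τ.isEmbedding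
  have eτ : ∀ W : Set (𝔼 2), τ '' ({p | thicken (flower g) p = level g} ∩ proj ⁻¹' W) =
      flowerSurface g ∩ proj ⁻¹' ((fun u => rot (ζC g m)⁻¹ (refl u)) '' W) := by
    intro W
    have : (τ : 𝔼 3 → 𝔼 3) = Rk g m ∘ refl3 := rfl
    rw [this, image_comp, image_refl3_inter_preimage, ← flowerSurface_def, image_Rk_inter hg, image_image]
  have e : τ '' ({p | thicken (flower g) p = level g} ∩ proj ⁻¹' (fanW g m ∩ collarU g m)) =
      (⋃ j ≤ m, secS g j) ∩ proj ⁻¹' (rot (ζC g m)⁻¹ '' (refl '' collarU g m)) := by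
    have hinj : Injective (fun u => rot (ζC g m)⁻¹ (refl u)) := (rot _).injective.comp refl.injective
    rw [eτ, image_inter hinj, image_fanSymm_fanW hg hm, preimage_inter, ← inter_assoc, ← iUnion_secS_eq hg hm, image_image]
  have eA : τ '' vArcSet g hg = range (arcK hg (m + 1)) := by
    show τ '' ({p | thicken (flower g) p = level g} ∩ proj ⁻¹' vRay g hg) = _
    rw [eτ, image_fanSymm_vRay hg m, range_arcK]
  rw [e, eA] at hT
  refine ⟨_, (isOpen_image_rot _ (isOpen_image_refl (isOpen_collarU hg hm))).preimage proj.continuous, ?_, hT⟩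
  have hsub := image_mono (f := τ) (vArcSet_subset_collar hg hm)
  rw [e, eA] at hsub
  exact hsub.trans inter_subset_right

/-- **The collar of the two closing arcs inside the last slice** (`g = n + 2`). [folklore] -/
theorem collar_last_secS {n : ℕ} (hg : 2 ≤ n + 2) :
    ∃ O : Set (𝔼 3), IsOpen O ∧ range (arcK hg (n + 1)) ∪ range (arcK hg 0) ⊆ O ∧
      IsStrongDeformationRetractOf (range (arcK hg (n + 1)) ∪ range (arcK hg 0)) (secS (n + 2) (n + 1) ∩ O) := by
  have h1 : (1 : ℕ) ≤ 1 := le_rfl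
  have h1g : 1 + 1 ≤ n + 2 := by omega
  have hT := isStrongDeformationRetractOf_vRay2 hg h1 h1g
  have eA : {p : 𝔼 3 | thicken (flower (n + 2)) p = level (n + 2)} ∩ proj ⁻¹' vRay2 (n + 2) 1 hg =
      range (arcK hg (n + 1)) ∪ range (arcK hg 0) := by
    rw [vRay2_one_eq hg, preimage_union, inter_union_distrib_left, ← flowerSurface_def, ← range_arcK, ← range_arcK, union_comm]
  have e : {p : 𝔼 3 | thicken (flower (n + 2)) p = level (n + 2)} ∩ proj ⁻¹' (fanF (n + 2) 1 ∩ collarU2 (n + 2) 1) =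
      secS (n + 2) (n + 1) ∩ proj ⁻¹' collarU2 (n + 2) 1 := by
    rw [preimage_inter, ← inter_assoc, ← flowerSurface_def, ← secW_last_eq_fanF hg, ← secS_eq hg]
  rw [eA, e] at hT
  refine ⟨_, (isOpen_collarU2 hg h1 h1g).preimage proj.continuous, ?_, hT⟩
  have hsub : {p : 𝔼 3 | thicken (flower (n + 2)) p = level (n + 2)} ∩ proj ⁻¹' vRay2 (n + 2) 1 hg ⊆
      {p | thicken (flower (n + 2)) p = level (n + 2)} ∩ proj ⁻¹' (fanF (n + 2) 1 ∩ collarU2 (n + 2) 1) :=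
    inter_subset_inter_right _ (preimage_mono (vRay2_subset hg h1 h1g))
  rw [eA, e] at hsub
  exact hsub.trans inter_subset_right

/-- **The collar of the two closing arcs inside the fan of the first `n + 1` slices** (`g = n + 2`). [folklore] -/
theorem collar_last_fan {n : ℕ} (hg : 2 ≤ n + 2) :
    ∃ O : Set (𝔼 3), IsOpen O ∧ range (arcK hg (n + 1)) ∪ range (arcK hg 0) ⊆ O ∧
      IsStrongDeformationRetractOf (range (arcK hg (n + 1)) ∪ range (arcK hg 0)) ((⋃ j ≤ n, secS (n + 2) j) ∩ O) := by
  have hk : 1 ≤ n + 1 := by omega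
  have hkg : n + 1 + 1 ≤ n + 2 := by omega
  have hpow : ((ζC (n + 2) 1 : Circle) : ℂ) ^ (n + 2) = 1 := ζC_pow (by omega) 1
  have hT := (isStrongDeformationRetractOf_vRay2 hg hk hkg).image_of_isEmbedding (rot3 (ζC (n + 2) 1)).isEmbedding
  have eA : rot3 (ζC (n + 2) 1) '' ({p : 𝔼 3 | thicken (flower (n + 2)) p = level (n + 2)} ∩ proj ⁻¹' vRay2 (n + 2) (n + 1) hg) =
      range (arcK hg (n + 1)) ∪ range (arcK hg 0) := by
    rw [image_rot3_inter_preimage hpow, image_rot_vRay2_last hg, preimage_union, inter_union_distrib_left,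
      ← flowerSurface_def, ← range_arcK, ← range_arcK]
  have e : rot3 (ζC (n + 2) 1) '' ({p : 𝔼 3 | thicken (flower (n + 2)) p = level (n + 2)} ∩
      proj ⁻¹' (fanF (n + 2) (n + 1) ∩ collarU2 (n + 2) (n + 1))) =
      (⋃ j ≤ n, secS (n + 2) j) ∩ proj ⁻¹' (rot (ζC (n + 2) 1) '' collarU2 (n + 2) (n + 1)) := by
    rw [image_rot3_inter_preimage hpow, image_inter (rot _).injective, image_rot_fanF_last hg, preimage_inter,
      ← inter_assoc, ← flowerSurface_def, ← iUnion_secS_eq hg (le_refl _)]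
  rw [eA, e] at hT
  refine ⟨_, (isOpen_image_rot _ (isOpen_collarU2 hg hk hkg)).preimage proj.continuous, ?_, hT⟩
  have hsub := image_mono (f := rot3 (ζC (n + 2) 1))
    (inter_subset_inter_right {p : 𝔼 3 | thicken (flower (n + 2)) p = level (n + 2)}
      (preimage_mono (f := proj) (vRay2_subset hg hk hkg)))
  rw [eA, e] at hsub
  exact hsub.trans inter_subset_right

/-! ### §4 The free bases of the slices -/

/-- **The free basis of `π₁` of the `k`-th slice at the upper pole, with the boundary word as relator
image**: transported from the standard sector along `Rk`. [folklore] -/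
theorem exists_basis_secS (hg : 2 ≤ g) (k : ℕ) :
    ∃ θ : FreeGroup (surfaceGen 1) ≃* FundamentalGroup (secS g k) ⟨top g, range_arcK_subset hg k ⟨0, (arcK hg k).source⟩⟩,
      θ (surfaceRelator 1) = bdryClass (secS g k) (range_arcK_subset hg k ⟨0, (arcK hg k).source⟩) (arcK hg k)
        (arcK hg (k + 1)) (fun t => range_arcK_subset hg k ⟨t, rfl⟩) (fun t => range_arcK_succ_subset hg k ⟨t, rfl⟩) := by
  obtain ⟨θ₀, hθ₀⟩ := exists_basis_sectorZ_bdry hg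
  let e : sectorZ g ≃ₜ secS g k := (Rk g k).image (sectorZ g)
  have he : e ⟨top g, top_mem_sectorZ hg⟩ = ⟨top g, range_arcK_subset hg k ⟨0, (arcK hg k).source⟩⟩ :=
    Subtype.ext (Rk_top g k)
  refine ⟨θ₀.trans (fundamentalGroupEquivOfHomeomorph e he), ?_⟩
  rw [MulEquiv.trans_apply, hθ₀, fundamentalGroupEquivOfHomeomorph_apply, _root_.FundamentalGroup.mapOfEq_apply]
  change Path.Homotopic.Quotient.mk _ = Path.Homotopic.Quotient.mk _
  refine congrArg Path.Homotopic.Quotient.mk ?_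
  ext t : 2
  apply Subtype.ext
  show Rk g k (((vArcR hg).trans (vArc hg).symm) t) = ((arcK hg (k + 1)).trans (arcK hg k).symm) t
  simp only [Path.trans_apply, Path.symm_apply, arcK_succ_apply]
  split_ifs <;> rfl

/-! ### §5 The melon decomposition and the marking -/

/-- **The slices cover the flower surface** (`g = n + 2`). [folklore] -/
theorem iUnion_secS_eq_flowerSurface {n : ℕ} (hg : 2 ≤ n + 2) : ⋃ j ≤ n + 1, secS (n + 2) j = flowerSurface (n + 2) := by
  apply Subset.antisymm
  · exact iUnion₂_subset fun j _ => (secS_eq hg j).le.trans inter_subset_left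
  · intro p hp
    have hq : flower (n + 2) (proj p) ≤ level (n + 2) := apply_proj_le_of_mem hp
    rcases flowerDomain_subset_fanW_union_secW hg hq with h | h
    · have hp' : p ∈ ⋃ j ≤ n, secS (n + 2) j := by rw [iUnion_secS_eq hg le_rfl]; exact ⟨hp, h⟩
      obtain ⟨j, hj, hpj⟩ := mem_iUnion₂.1 hp'
      exact mem_iUnion₂.2 ⟨j, Nat.le_succ_of_le hj, hpj⟩
    · exact mem_iUnion₂.2 ⟨n + 1, le_rfl, by rw [secS_eq hg]; exact ⟨hp, h⟩⟩

/-- **`π₁` of the flower surface of genus `n + 2` is the surface group**, at every base point: the melon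
decomposition theorem applied to the slices and arcs. [folklore] -/
theorem flowerSurface_marking_add_two {n : ℕ} (hg : 2 ≤ n + 2) (z : flowerSurface (n + 2)) :
    Nonempty (SurfaceGroup (n + 2) ≃* FundamentalGroup (flowerSurface (n + 2)) z) := by
  refine nonempty_surfaceGroup_mulEquiv_of_melon (n := n) (secS (n + 2)) (arcK hg)
    (fun k _ => isClosed_secS hg k) (fun k _ => isPathConnected_secS hg k)
    (fun k _ => range_arcK_subset hg k) (fun k _ => range_arcK_succ_subset hg k) (arcK_period hg)
    ?_ (fun k hk hkn => collar_fan hg hk (by omega)) (fun k _ _ => collar_secS hg k)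
    (fun k _ _ => isSimplyConnected_range_arcK hg k) ?_ (collar_last_fan hg) (collar_last_secS hg)
    (injective_arcK hg _) (injective_arcK hg _) (arcK_meet hg)
    (fun k _ => (exists_basis_secS hg k).choose) (fun k _ => (exists_basis_secS hg k).choose_spec)
    (flowerSurface (n + 2)) (iUnion_secS_eq_flowerSurface hg) z
  · intro k hk hkn
    rw [iUnion_secS_eq hg (by omega), secS_eq hg, range_arcK, ← inter_inter_distrib_left, ← preimage_inter]
    exact inter_subset_inter_right _ (preimage_mono (fanW_inter_secW_subset hg hk (by omega)))
  · rw [iUnion_secS_eq hg le_rfl, secS_eq hg, range_arcK, range_arcK, ← inter_inter_distrib_left, ← preimage_inter,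
      ← inter_union_distrib_left, ← preimage_union]
    exact inter_subset_inter_right _ (preimage_mono (fanW_inter_secW_last_subset hg))

/-- **M2 — the flower surface of genus `g ≥ 2` is marked by the surface group `S_g`** at every base
point. [folklore] -/
theorem flowerSurface_marking (hg : 2 ≤ g) (z : {p : 𝔼 3 | thicken (flower g) p = level g}) :
    Nonempty (SurfaceGroup g ≃* FundamentalGroup {p : 𝔼 3 | thicken (flower g) p = level g} z) := by
  obtain ⟨n, rfl⟩ : ∃ n, g = n + 2 := ⟨g - 2, by omega⟩
  exact flowerSurface_marking_add_two hg z

end FlowerModel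

/-! ### §6 The marking of the central surface of a balanced Gay–Kirby trisection -/

/-- **(g′) from L1**: granted the standard one-handle lemma `oneHandle_nonempty_diffeomorph`, the central
surface of every balanced `(g, k)` Gay–Kirby trisection of a closed connected oriented smooth
`4`-manifold is marked by the surface group `S_g` (Gay–Kirby: the central surface is a closed
orientable surface of genus `g`). Genus `0` and `1` are the landed special cases; genus `g ≥ 2` is the
flower model marked by `FlowerModel.flowerSurface_marking`. [cite: GayKirby2016, Def. 1] [cite: HatcherAT2002, §1.2 p. 51] -/
theorem exists_marking_centralSurface_of_gkTrisection_of_oneHandle (h₁ : oneHandle_nonempty_diffeomorph.{u}) :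
    exists_marking_centralSurface_of_gkTrisection.{u} := by
  intro X _ _ _ _ _ _ _ o g k S h
  rcases Nat.lt_or_ge g 2 with hg | hg
  · interval_cases g
    · exact exists_marking_centralSurface_of_gkTrisection_of_genus_zero X o k S h
    · exact exists_marking_centralSurface_of_gkTrisection_genusOne_of_oneHandle h₁ X o k S h
  · exact exists_marking_centralSurface_of_flower_marking hg h₁ (FlowerModel.flowerSurface_marking hg) X o k S h

/-- **(g′) — discharge of `exists_marking_centralSurface_of_gkTrisection`**: the central surface of every
balanced `(g, k)` Gay–Kirby trisection of a closed connected oriented smooth `4`-manifold is marked by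
the surface group `S_g`, i.e. `π₁(X₁ ∩ X₂ ∩ X₃, x₀) ≅ S_g` for some base point (Gay–Kirby: the central
surface is a closed orientable surface of genus `g`).  Assembled from the one-handle lemma
`oneHandle_nonempty_diffeomorph_holds` (L1) and `exists_marking_centralSurface_of_gkTrisection_of_oneHandle`.
[cite: GayKirby2016, Def. 1] [cite: HatcherAT2002, §1.2 p. 51] -/
theorem exists_marking_centralSurface_of_gkTrisection_holds : exists_marking_centralSurface_of_gkTrisection.{u} :=
  exists_marking_centralSurface_of_gkTrisection_of_oneHandle oneHandle_nonempty_diffeomorph_holds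


end Literature.Topology.FourManifolds
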